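import Summits.AtomisticToContinuum.BoseEinsteinCondensation.Theses.BECInfraredBound
import Summits.AtomisticToContinuum.BoseEinsteinCondensation.Theorems.BECGroundStateSOSIRModeCounting
import Summits.AtomisticToContinuum.BoseEinsteinCondensation.Theorems.BECThomsonPrincipleGDTransferWindowLaw

/-!
# Route BECInfraredBound, crux `BecWindowCount` (stmt-AtomisticToContinuum-9015)

Closes `Summit.AtomisticToContinuum.BoseEinsteinCondensation.Theses.BECInfraredBound.BecWindowCount`
(mode-counting glue 1/3 of the route): for every repulsive finite-range `v`, the window infrared bound
`⟨φ'_k, γ_Ψ φ'_k⟩ ≤ C(1 + √ρL/‖k‖∞)` on `0 < ‖k‖∞ ≤ K√ρL` for `δ`-near-minimisers implies that the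
infrared window carries an arbitrarily small particle fraction, `Σ_{0<‖k‖∞≤K√ρL} ⟨φ'_k, γ_Ψ φ'_k⟩ ≤ ηN`
for every `η > 0`, once `ρ < ρ₀` and eventually in `N`.

Proof (line `in-tree-counts-homogeneous` of the crux chain; both lattice counts are already in tree in
HOMOGENEOUS form):
* the `ℝ≥0∞` tsum over the window subtype `{k ≠ 0 ∧ ‖k‖∞ ≤ R}` is dominated by the `Finset` sum over
  the punctured cube `{-M,…,M}³ ∖ 0`, `M = ⌊R⌋₊` (`ModeCounting.mem_latticeBox_floor_of_norm_le`);
* `#({-M,…,M}³ ∖ 0) ≤ 26M³` (`GDTransfer.DysonDressedWitness.card_latticeShell_le`) and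
  `Σ_{0<‖k‖∞≤M} 1/‖k‖∞ ≤ 26M²` (`ModeCounting.sum_inv_norm_latticeShell_le_sq`), so the window profile
  sum is `≤ 26R³ + 26·s·R²` at `s = √ρL`, `R = K s`;
* `(√ρ·L)³ = √ρ·N` exactly (`BoseGas.sideLength_pow_three`), so the window mass is
  `≤ 26C(K³+K²)√ρ·N` for EVERY `N`; with `ρ₀ := min ρ₀^IR (η/(26(K³+K²)C))²` this is `≤ ηN`, on the
  infrared bound's own eventuality set in `N` and with its own slack `δ`.

## References

* [LSSY2005] Lieb, Seiringer, Solovej, Yngvason, *The Mathematics of the Bose Gas and its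
  Condensation* (2005), Ch. 11 (11.26)–(11.27) (finiteness of the infrared mode sum in `d = 3`).
* [DysonLiebSimon1978] Dyson, Lieb, Simon, J. Stat. Phys. 18 (1978), §4.
-/

noncomputable section

open Filter
open scoped ENNReal BigOperators

namespace Summit.AtomisticToContinuum.BoseEinsteinCondensation.Theorems

namespace BECInfraredBoundWindowCount

open Literature.MathematicalPhysics.QuantumManyBody.BoseGas
open Summit.AtomisticToContinuum.BoseEinsteinCondensation.Theorems.ModeCounting
  (mem_latticeBox_floor_of_norm_le sum_inv_norm_latticeShell_le_sq)
open Summit.AtomisticToContinuum.BoseEinsteinCondensation.Cruxes.GDTransfer.DysonDressedWitness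
  (card_latticeShell_le)

/-- Currency adapter: an `ℝ≥0∞` tsum over the window subtype `{k ≠ 0 ∧ ‖k‖∞ ≤ R}` of `ℤ³` is
dominated by the `Finset` sum over the punctured cube `{-⌊R⌋₊,…,⌊R⌋₊}³ ∖ 0` (the window embeds into
it by `mem_latticeBox_floor_of_norm_le`; nonnegativity does the rest). [folklore] -/
theorem window_tsum_le_sum (R : ℝ) (f : (Fin 3 → ℤ) → ℝ≥0∞) :
    ∑' k : {k : Fin 3 → ℤ // k ≠ 0 ∧ ‖(fun j => (k j : ℝ))‖ ≤ R}, f k.1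
      ≤ ∑ k ∈ ((Fintype.piFinset fun _ : Fin 3 =>
          Finset.Icc (-((⌊R⌋₊ : ℕ) : ℤ)) ((⌊R⌋₊ : ℕ) : ℤ))).erase 0, f k := by
  classical
  set S : Set (Fin 3 → ℤ) := {k | k ≠ 0 ∧ ‖(fun j => (k j : ℝ))‖ ≤ R} with hS
  set F : Finset (Fin 3 → ℤ) := ((Fintype.piFinset fun _ : Fin 3 =>
      Finset.Icc (-((⌊R⌋₊ : ℕ) : ℤ)) ((⌊R⌋₊ : ℕ) : ℤ))).erase 0 with hF
  have hSF : S ⊆ (F : Set (Fin 3 → ℤ)) := by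
    rintro k ⟨hk0, hkR⟩
    exact Finset.mem_coe.2 (Finset.mem_erase.2 ⟨hk0, mem_latticeBox_floor_of_norm_le hkR⟩)
  calc ∑' k : {k : Fin 3 → ℤ // k ≠ 0 ∧ ‖(fun j => (k j : ℝ))‖ ≤ R}, f k.1
      = ∑' k, S.indicator f k := tsum_subtype S f
    _ ≤ ∑' k, (F : Set (Fin 3 → ℤ)).indicator f k :=
        ENNReal.tsum_le_tsum fun k =>
          Set.indicator_le_indicator_of_subset hSF (fun _ => zero_le) k
    _ = ∑ k ∈ F, f k := (sum_eq_tsum_indicator f F).symm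

/-- Homogeneous window profile bound: for `R, s ≥ 0`,
`Σ'_{k ≠ 0, ‖k‖∞ ≤ R} ofReal (1 + s/‖k‖∞) ≤ ofReal (26R³ + 26·s·R²)` — the punctured cube of radius
`M = ⌊R⌋₊ ≤ R` has `≤ 26M³` points and harmonic shell sum `≤ 26M²` (both in tree).
(Lieb–Seiringer–Solovej–Yngvason 2005, Ch. 11, mode counting in `d = 3`.) [folklore] -/
theorem windowProfile_sum_le {R s : ℝ} (hR : 0 ≤ R) (hs : 0 ≤ s) :
    ∑' k : {k : Fin 3 → ℤ // k ≠ 0 ∧ ‖(fun j => (k j : ℝ))‖ ≤ R},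
        ENNReal.ofReal (1 + s / ‖(fun j => (k.1 j : ℝ))‖)
      ≤ ENNReal.ofReal (26 * R ^ 3 + 26 * s * R ^ 2) := by
  classical
  set M : ℕ := ⌊R⌋₊ with hM
  have hMR : (M : ℝ) ≤ R := Nat.floor_le hR
  refine (window_tsum_le_sum R (fun k =>
    ENNReal.ofReal (1 + s / ‖(fun j : Fin 3 => ((k j : ℤ) : ℝ))‖))).trans ?_
  rw [← ENNReal.ofReal_sum_of_nonneg (fun k _ => by positivity)]
  refine ENNReal.ofReal_le_ofReal ?_
  calc ∑ k ∈ ((Fintype.piFinset fun _ : Fin 3 =>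
          Finset.Icc (-((M : ℕ) : ℤ)) ((M : ℕ) : ℤ))).erase 0,
          (1 + s / ‖(fun j : Fin 3 => ((k j : ℤ) : ℝ))‖)
      = (((((Fintype.piFinset fun _ : Fin 3 =>
            Finset.Icc (-((M : ℕ) : ℤ)) ((M : ℕ) : ℤ))).erase 0).card : ℕ) : ℝ)
          + s * ∑ k ∈ ((Fintype.piFinset fun _ : Fin 3 =>
            Finset.Icc (-((M : ℕ) : ℤ)) ((M : ℕ) : ℤ))).erase 0,
              1 / ‖(fun j : Fin 3 => ((k j : ℤ) : ℝ))‖ := by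
        rw [Finset.sum_add_distrib, Finset.sum_const, nsmul_eq_mul, mul_one, Finset.mul_sum]
        congr 1
        exact Finset.sum_congr rfl fun k _ => by ring
    _ ≤ 26 * (M : ℝ) ^ 3 + s * (26 * (M : ℝ) ^ 2) := by
        gcongr
        · exact card_latticeShell_le M
        · exact sum_inv_norm_latticeShell_le_sq M
    _ ≤ 26 * R ^ 3 + s * (26 * R ^ 2) := by gcongr
    _ = 26 * R ^ 3 + 26 * s * R ^ 2 := by ring

/-- Thermodynamic scaling, exact: with `L = sideLength ρ N = (N/ρ)^{1/3}`, `(√ρ·L)³ = √ρ·N`, so the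
homogeneous window bound at `R = K√ρL`, `s = √ρL` is the pure multiple `26(K³+K²)√ρ·N` of `N`.
[folklore] -/
theorem window_scaling {ρ : ℝ} (hρ : 0 < ρ) (K : ℝ) (N : ℕ) :
    26 * (K * Real.sqrt ρ * sideLength ρ N) ^ 3
        + 26 * (Real.sqrt ρ * sideLength ρ N) * (K * Real.sqrt ρ * sideLength ρ N) ^ 2
      = 26 * (K ^ 3 + K ^ 2) * Real.sqrt ρ * N := by
  have hL3 : sideLength ρ N ^ 3 = N / ρ := sideLength_pow_three hρ N
  have hs3 : Real.sqrt ρ ^ 3 = ρ * Real.sqrt ρ := by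
    rw [pow_succ, Real.sq_sqrt hρ.le]
  have h3 : (Real.sqrt ρ * sideLength ρ N) ^ 3 = Real.sqrt ρ * N := by
    rw [mul_pow, hs3, hL3]
    field_simp
  calc 26 * (K * Real.sqrt ρ * sideLength ρ N) ^ 3
        + 26 * (Real.sqrt ρ * sideLength ρ N) * (K * Real.sqrt ρ * sideLength ρ N) ^ 2
      = 26 * (K ^ 3 + K ^ 2) * (Real.sqrt ρ * sideLength ρ N) ^ 3 := by ring
    _ = 26 * (K ^ 3 + K ^ 2) * Real.sqrt ρ * N := by rw [h3]; ring

end BECInfraredBoundWindowCount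

open Literature.MathematicalPhysics.QuantumManyBody.BoseGas
open BECInfraredBoundWindowCount

/-- **`BecWindowCount`** (route `BECInfraredBound`, closes stmt-AtomisticToContinuum-9015, exact route
decl): the window infrared bound for `v` implies that the infrared window `0 < ‖k‖∞ ≤ K√ρL` carries at
most `ηN` particles for every `η > 0`, once `ρ < ρ₀ := min ρ₀^IR (η/A)²`, `A = 26(K³+K²)C`, on the
infrared bound's own eventuality set in `N` and with the same slack `δ` (nothing is absorbed
"eventually in `N`": the homogeneous lattice counts give `≤ 26C(K³+K²)√ρ·N` for every `N`).
(Lieb–Seiringer–Solovej–Yngvason 2005, Ch. 11 (11.26)–(11.27); Dyson–Lieb–Simon 1978, §4.) [folklore] -/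
theorem becWindowCount_proof :
    Summit.AtomisticToContinuum.BoseEinsteinCondensation.Theses.BECInfraredBound.BecWindowCount := by
  intro v _hv hIR ε hε hε4 K hK η hη
  obtain ⟨ρ₁, hρ₁, C, hC, H1⟩ := hIR ε hε hε4 K hK
  set A : ℝ := 26 * (K ^ 3 + K ^ 2) * C with hA
  have hA0 : 0 < A := by positivity
  set ρ₂ : ℝ := (η / A) ^ 2 with hρ₂
  have hρ₂0 : 0 < ρ₂ := by positivity
  refine ⟨min ρ₁ ρ₂, lt_min hρ₁ hρ₂0, fun ρ hρ hρlt => ?_⟩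
  have hρ1 : ρ < ρ₁ := lt_of_lt_of_le hρlt (min_le_left _ _)
  have hρ2 : ρ < ρ₂ := lt_of_lt_of_le hρlt (min_le_right _ _)
  have hsq : A * Real.sqrt ρ ≤ η := by
    have h1 : Real.sqrt ρ < η / A := by
      calc Real.sqrt ρ < Real.sqrt ρ₂ := Real.sqrt_lt_sqrt hρ.le hρ2
        _ = η / A := by rw [hρ₂, Real.sqrt_sq (by positivity)]
    rw [lt_div_iff₀ hA0] at h1
    linarith
  filter_upwards [H1 ρ hρ hρ1] with N hN
  obtain ⟨δ, hδ, HΨ⟩ := hN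
  refine ⟨δ, hδ, fun Ψ hΨ => ?_⟩
  have hL0 : 0 ≤ sideLength ρ N := sideLength_nonneg hρ.le N
  have hs0 : 0 ≤ Real.sqrt ρ * sideLength ρ N := by positivity
  have hR0 : 0 ≤ K * Real.sqrt ρ * sideLength ρ N := by positivity
  have hpt := fun k : {k : Fin 3 → ℤ // k ≠ 0 ∧ ‖(fun j => (k j : ℝ))‖ ≤
      K * Real.sqrt ρ * sideLength ρ N} => HΨ Ψ hΨ k.1 k.2.1 k.2.2
  refine (ENNReal.tsum_le_tsum hpt).trans ?_
  have hmul : ∀ k : {k : Fin 3 → ℤ // k ≠ 0 ∧ ‖(fun j => (k j : ℝ))‖ ≤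
      K * Real.sqrt ρ * sideLength ρ N},
      ENNReal.ofReal (C * (1 + Real.sqrt ρ * sideLength ρ N / ‖(fun j => (k.1 j : ℝ))‖))
        = ENNReal.ofReal C *
          ENNReal.ofReal (1 + Real.sqrt ρ * sideLength ρ N / ‖(fun j => (k.1 j : ℝ))‖) :=
    fun k => ENNReal.ofReal_mul hC.le
  rw [tsum_congr hmul, ENNReal.tsum_mul_left]
  calc ENNReal.ofReal C * ∑' k : {k : Fin 3 → ℤ // k ≠ 0 ∧ ‖(fun j => (k j : ℝ))‖ ≤
          K * Real.sqrt ρ * sideLength ρ N},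
          ENNReal.ofReal (1 + Real.sqrt ρ * sideLength ρ N / ‖(fun j => (k.1 j : ℝ))‖)
      ≤ ENNReal.ofReal C * ENNReal.ofReal (26 * (K * Real.sqrt ρ * sideLength ρ N) ^ 3
          + 26 * (Real.sqrt ρ * sideLength ρ N) * (K * Real.sqrt ρ * sideLength ρ N) ^ 2) := by
        gcongr
        exact windowProfile_sum_le hR0 hs0
    _ = ENNReal.ofReal (C * (26 * (K ^ 3 + K ^ 2) * Real.sqrt ρ * N)) := by
        rw [← ENNReal.ofReal_mul hC.le, window_scaling hρ K N]
    _ ≤ ENNReal.ofReal (η * N) := by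
        refine ENNReal.ofReal_le_ofReal ?_
        calc C * (26 * (K ^ 3 + K ^ 2) * Real.sqrt ρ * N) = (A * Real.sqrt ρ) * N := by
              rw [hA]; ring
          _ ≤ η * N := mul_le_mul_of_nonneg_right hsq (Nat.cast_nonneg N)

end Summit.AtomisticToContinuum.BoseEinsteinCondensation.Theorems

end
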